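import Mathlib.Algebra.BigOperators.Fin
import Mathlib.Data.ZMod.Basic
import Literature.Computability.QuantumComplexity.IQPForrelation

/-!
# Crux `CubicForrelation.NearExactIsExact` (stmt-QuantumAdvantage-14043) — the cubic form `s₀ ∧ ω_{2h}` AT UNIT VECTORS: the tensor
  table `hT`, `hlo`, `hhi` of the ω-leaves

Certificate seat `b2b-cforr-cert` (gen 41).  HONEST FRAMING: kernel-checked bookkeeping (standard axioms; Mathlib + the tree's bit vectors).
…CubicFormLightCoords / …CubicFormCellL2 express "the cubic form is `s₀ ∧ ω_{2h}`" as an identity for the third differences along arbitrary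
`u, v, w`; the R2 leaves (…TwelvePartnerR2LeafW8 `tpa_R2_w8`: hypotheses `hT`, `hlo`, `hhi`) want the `𝔽₂`-tensor of its values at unit
vectors.  This file does that evaluation once and for all (step (2), last paragraph, of HOME/b2b-cforr-cert-g41/ASSEMBLY-BLUEPRINT-W8.md).
Nothing about `θ₁₂`; NOT summit progress.

* `tlu_unit_table`: for `f` on `1 + n` bits with third differences `u₀·ω(v,w) ⊕ v₀·ω(u,w) ⊕ w₀·ω(u,v)`,
  `ω(v,w) = [Σᵢ v_{lo i} w_{hi i} + v_{hi i} w_{lo i} = 1]`, the tensor `d(a,b,c) = [T3 f(e_a,e_b,e_c)(0)] ∈ 𝔽₂` satisfies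
  `d(0,s,u) = Σ_q [(s,u) = (lo q, hi q) ∨ (hi q, lo q)]`, `d(lo q,s,u) = [(s,u) = (0, hi q) ∨ (hi q, 0)]`, `d(hi q,s,u) = [(s,u) = (0, lo q) ∨ (lo q, 0)]`
  (coordinates of `Fin (1 + n)`: `0 = castAdd n 0`, `lo q ↦ natAdd 1 (lo q)`).

References: folklore.  Axioms: the standard three.
-/

set_option linter.dupNamespace false -- D-0017: single-problem summit ⇒ `QuantumAdvantage.QuantumAdvantage` by design

namespace Summit.QuantumAdvantage.QuantumAdvantage.Theorems.CubicForrelation.NearExactIsExact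

open Finset
open Literature.Computability.QuantumComplexity.BuzetChailloux (bxor zeroVec)

/-- **The cubic form `s₀ ∧ ω_{2h}` at unit vectors.**  See the module docstring. [folklore] -/
theorem tlu_unit_table {n h : ℕ} (f : (Fin (1 + n) → Bool) → Bool) (lo hi : Fin h → Fin n)
    (hlo : Function.Injective lo) (hhi : Function.Injective hi) (hlohi : ∀ i j, lo i ≠ hi j)
    (ω' : (Fin n → Bool) → (Fin n → Bool) → Bool)
    (hω' : ∀ v w, ω' v w = decide ((∑ i : Fin h, ((if v (lo i) = true then (1 : ZMod 2) else 0) * (if w (hi i) = true then (1 : ZMod 2) else 0) +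
        (if v (hi i) = true then (1 : ZMod 2) else 0) * (if w (lo i) = true then (1 : ZMod 2) else 0))) = 1))
    (hT : ∀ u v w x : Fin (1 + n) → Bool,
      (((f x ^^ f (bxor x w)) ^^ (f (bxor x v) ^^ f (bxor (bxor x v) w))) ^^
          ((f (bxor x u) ^^ f (bxor (bxor x u) w)) ^^ (f (bxor (bxor x u) v) ^^ f (bxor (bxor (bxor x u) v) w)))) =
        (((u (Fin.castAdd n (0 : Fin 1)) && ω' (fun j => v (Fin.natAdd 1 j)) (fun j => w (Fin.natAdd 1 j))) ^^
            (v (Fin.castAdd n (0 : Fin 1)) && ω' (fun j => u (Fin.natAdd 1 j)) (fun j => w (Fin.natAdd 1 j)))) ^^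
          (w (Fin.castAdd n (0 : Fin 1)) && ω' (fun j => u (Fin.natAdd 1 j)) (fun j => v (Fin.natAdd 1 j))))) :
    let e : Fin (1 + n) → (Fin (1 + n) → Bool) := fun a l => decide (l = a)
    let d : Fin (1 + n) → Fin (1 + n) → Fin (1 + n) → ZMod 2 := fun a b c =>
      if (((f zeroVec ^^ f (bxor zeroVec (e c))) ^^ (f (bxor zeroVec (e b)) ^^ f (bxor (bxor zeroVec (e b)) (e c)))) ^^
          ((f (bxor zeroVec (e a)) ^^ f (bxor (bxor zeroVec (e a)) (e c))) ^^
            (f (bxor (bxor zeroVec (e a)) (e b)) ^^ f (bxor (bxor (bxor zeroVec (e a)) (e b)) (e c))))) = true then 1 else 0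
    (∀ s u : Fin (1 + n), d (Fin.castAdd n 0) s u =
      ∑ q, (if (s = Fin.natAdd 1 (lo q) ∧ u = Fin.natAdd 1 (hi q)) ∨ (s = Fin.natAdd 1 (hi q) ∧ u = Fin.natAdd 1 (lo q))
        then (1 : ZMod 2) else 0)) ∧
    (∀ q (s u : Fin (1 + n)), d (Fin.natAdd 1 (lo q)) s u =
      if (s = Fin.castAdd n 0 ∧ u = Fin.natAdd 1 (hi q)) ∨ (s = Fin.natAdd 1 (hi q) ∧ u = Fin.castAdd n 0) then 1 else 0) ∧
    (∀ q (s u : Fin (1 + n)), d (Fin.natAdd 1 (hi q)) s u =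
      if (s = Fin.castAdd n 0 ∧ u = Fin.natAdd 1 (lo q)) ∨ (s = Fin.natAdd 1 (lo q) ∧ u = Fin.castAdd n 0) then 1 else 0) := by
  classical
  intro e d
  -- index facts
  have hzn : ∀ a' : Fin n, (Fin.castAdd n (0 : Fin 1)) ≠ Fin.natAdd 1 a' := fun a' h' => by
    have := congrArg Fin.val h'
    simp only [Fin.val_castAdd, Fin.val_natAdd, Fin.val_zero] at this
    omega
  -- the tensor in terms of `ω'` and the first coordinates
  have hd : ∀ a b c, d a b c = if (((e a (Fin.castAdd n 0) && ω' (fun j => e b (Fin.natAdd 1 j)) (fun j => e c (Fin.natAdd 1 j))) ^^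
      (e b (Fin.castAdd n 0) && ω' (fun j => e a (Fin.natAdd 1 j)) (fun j => e c (Fin.natAdd 1 j)))) ^^
      (e c (Fin.castAdd n 0) && ω' (fun j => e a (Fin.natAdd 1 j)) (fun j => e b (Fin.natAdd 1 j)))) = true then 1 else 0 := by
    intro a b c; simp only [d]; rw [hT]
  -- unit vectors: first coordinate and tail
  have e0z : e (Fin.castAdd n 0) (Fin.castAdd n 0) = true := decide_eq_true rfl
  have e0n : ∀ a' : Fin n, e (Fin.natAdd 1 a') (Fin.castAdd n 0) = false := fun a' => decide_eq_false (hzn a')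
  have etz : (fun j => e (Fin.castAdd n 0) (Fin.natAdd 1 j)) = (zeroVec : Fin n → Bool) :=
    funext fun j => decide_eq_false (fun h' => hzn j h'.symm)
  have etn : ∀ a' : Fin n, (fun j => e (Fin.natAdd 1 a') (Fin.natAdd 1 j)) = fun j => decide (j = a') := by
    intro a'; funext j
    show decide (_ = _) = decide (_ = _)
    by_cases hj : j = a'
    · rw [hj, decide_eq_true rfl, decide_eq_true rfl]
    · rw [decide_eq_false hj, decide_eq_false (fun h' => hj ((Fin.natAdd_inj 1).mp h'))]
  -- values of `ω'`
  have hread : ∀ t : ZMod 2, (if decide (t = 1) = true then (1 : ZMod 2) else 0) = t := by decide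
  have hω0l : ∀ w, ω' zeroVec w = false := by
    intro w; rw [hω']; simp [zeroVec]
  have hω0r : ∀ w, ω' w zeroVec = false := by
    intro w; rw [hω']; simp [zeroVec]
  have hlolo : ∀ i j, decide (lo i = lo j) = decide (i = j) := fun i j => by
    by_cases hij : i = j
    · rw [hij]; simp
    · rw [decide_eq_false (fun h' => hij (hlo h')), decide_eq_false hij]
  have hhihi : ∀ i j, decide (hi i = hi j) = decide (i = j) := fun i j => by
    by_cases hij : i = j
    · rw [hij]; simp
    · rw [decide_eq_false (fun h' => hij (hhi h')), decide_eq_false hij]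
  have hlh : ∀ i j, decide (lo i = hi j) = false := fun i j => decide_eq_false (hlohi i j)
  have hhl : ∀ i j, decide (hi i = lo j) = false := fun i j => decide_eq_false (fun h' => hlohi j i h'.symm)
  have hωlo : ∀ (q : Fin h) (w : Fin n → Bool), ω' (fun j => decide (j = lo q)) w = w (hi q) := by
    intro q w; rw [hω']
    simp only [hlolo, hhl, decide_eq_true_eq]
    simp only [Bool.false_eq_true, if_false, zero_mul, add_zero, ite_mul, one_mul, sum_ite_eq', mem_univ, if_true]
    cases w (hi q) <;> decide
  have hωhi : ∀ (q : Fin h) (w : Fin n → Bool), ω' (fun j => decide (j = hi q)) w = w (lo q) := by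
    intro q w; rw [hω']
    simp only [hhihi, hlh, decide_eq_true_eq]
    simp only [Bool.false_eq_true, if_false, zero_mul, zero_add, ite_mul, one_mul, sum_ite_eq', mem_univ, if_true]
    cases w (lo q) <;> decide
  have L : ∀ (A B C D : Prop) [Decidable A] [Decidable B] [Decidable C] [Decidable D], ¬ (A ∧ C) →
      ((if A then 1 else 0) * (if B then 1 else 0) + (if C then 1 else 0) * (if D then 1 else 0) : ZMod 2) =
        if (A ∧ B) ∨ (C ∧ D) then 1 else 0 := by
    intro A B C D _ _ _ _
    by_cases hA : A <;> by_cases hB : B <;> by_cases hC : C <;> by_cases hD : D <;> simp [hA, hB, hC, hD]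
  have hωss : ∀ s' u' : Fin n, (if ω' (fun j => decide (j = s')) (fun j => decide (j = u')) = true then (1 : ZMod 2) else 0) =
      ∑ q, (if (s' = lo q ∧ u' = hi q) ∨ (s' = hi q ∧ u' = lo q) then (1 : ZMod 2) else 0) := by
    intro s' u'
    rw [hω', hread]
    refine sum_congr rfl fun q _ => ?_
    simp only [decide_eq_true_eq]
    rw [L _ _ _ _ (fun hac => hlohi q q (hac.1.trans hac.2.symm))]
    congr 1
    exact propext ⟨fun h' => h'.elim (fun ⟨a, b⟩ => Or.inl ⟨a.symm, b.symm⟩) (fun ⟨c, d⟩ => Or.inr ⟨c.symm, d.symm⟩),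
      fun h' => h'.elim (fun ⟨a, b⟩ => Or.inl ⟨a.symm, b.symm⟩) (fun ⟨c, d⟩ => Or.inr ⟨c.symm, d.symm⟩)⟩
  -- pointwise tail facts
  have etz' : ∀ j, e (Fin.castAdd n 0) (Fin.natAdd 1 j) = false := fun j => congrFun etz j
  have etn' : ∀ a' j, e (Fin.natAdd 1 a') (Fin.natAdd 1 j) = decide (j = a') := fun a' j => congrFun (etn a') j
  refine ⟨fun s u => ?_, fun q s u => ?_, fun q s u => ?_⟩
  · rw [hd, e0z, etz, hω0l, hω0l, Bool.and_false, Bool.and_false, Bool.xor_false, Bool.xor_false, Bool.true_and]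
    refine Fin.addCases (fun o => ?_) (fun s' => ?_) s <;> refine Fin.addCases (fun o' => ?_) (fun u' => ?_) u
    · have ho : o = 0 := Fin.eq_zero o
      have ho' : o' = 0 := Fin.eq_zero o'
      subst ho; subst ho'
      rw [etz, hω0l]
      simp only [Bool.false_eq_true, if_false]
      symm; refine sum_eq_zero fun q _ => ?_
      rw [if_neg]; rintro (⟨h1, -⟩ | ⟨h1, -⟩) <;> exact hzn _ h1
    · have ho : o = 0 := Fin.eq_zero o
      subst ho
      rw [etz, hω0l]
      simp only [Bool.false_eq_true, if_false]
      symm; refine sum_eq_zero fun q _ => ?_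
      rw [if_neg]; rintro (⟨h1, -⟩ | ⟨h1, -⟩) <;> exact hzn _ h1
    · have ho' : o' = 0 := Fin.eq_zero o'
      subst ho'
      rw [etz, etn, hω0r]
      simp only [Bool.false_eq_true, if_false]
      symm; refine sum_eq_zero fun q _ => ?_
      rw [if_neg]; rintro (⟨-, h2⟩ | ⟨-, h2⟩) <;> exact hzn _ h2
    · rw [etn, etn, hωss]
      refine sum_congr rfl fun q _ => ?_
      simp only [Fin.natAdd_inj]
  · rw [hd, e0n, etn, Bool.false_and, Bool.false_xor, hωlo, hωlo]
    refine Fin.addCases (fun o => ?_) (fun s' => ?_) s <;> refine Fin.addCases (fun o' => ?_) (fun u' => ?_) u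
    · have ho : o = 0 := Fin.eq_zero o
      have ho' : o' = 0 := Fin.eq_zero o'
      subst ho; subst ho'
      simp only [e0z, etz', Bool.and_false, Bool.xor_false, Bool.false_eq_true, if_false]
      rw [if_neg]; rintro (⟨-, h2⟩ | ⟨h1, -⟩)
      · exact hzn _ h2
      · exact hzn _ h1
    · have ho : o = 0 := Fin.eq_zero o
      subst ho
      simp only [e0z, e0n, etn', Bool.true_and, Bool.false_and, Bool.xor_false]
      by_cases hu : u' = hi q
      · subst hu; simp
      · rw [decide_eq_false (fun h' => hu h'.symm)]
        simp only [Bool.false_eq_true, if_false]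
        rw [if_neg]; rintro (⟨-, h2⟩ | ⟨h1, -⟩)
        · exact hu ((Fin.natAdd_inj 1).mp h2)
        · exact hzn _ h1
    · have ho' : o' = 0 := Fin.eq_zero o'
      subst ho'
      simp only [e0z, e0n, etn', Bool.true_and, Bool.false_and, Bool.false_xor]
      by_cases hs : s' = hi q
      · subst hs; simp
      · rw [decide_eq_false (fun h' => hs h'.symm)]
        simp only [Bool.false_eq_true, if_false]
        rw [if_neg]; rintro (⟨h1, -⟩ | ⟨h1, -⟩)
        · exact hzn _ h1.symm
        · exact hs ((Fin.natAdd_inj 1).mp h1)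
    · simp only [e0n, Bool.false_and, Bool.xor_false, Bool.false_eq_true, if_false]
      rw [if_neg]; rintro (⟨h1, -⟩ | ⟨-, h2⟩)
      · exact hzn _ h1.symm
      · exact hzn _ h2.symm
  · rw [hd, e0n, etn, Bool.false_and, Bool.false_xor, hωhi, hωhi]
    refine Fin.addCases (fun o => ?_) (fun s' => ?_) s <;> refine Fin.addCases (fun o' => ?_) (fun u' => ?_) u
    · have ho : o = 0 := Fin.eq_zero o
      have ho' : o' = 0 := Fin.eq_zero o'
      subst ho; subst ho'
      simp only [e0z, etz', Bool.and_false, Bool.xor_false, Bool.false_eq_true, if_false]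
      rw [if_neg]; rintro (⟨-, h2⟩ | ⟨h1, -⟩)
      · exact hzn _ h2
      · exact hzn _ h1
    · have ho : o = 0 := Fin.eq_zero o
      subst ho
      simp only [e0z, e0n, etn', Bool.true_and, Bool.false_and, Bool.xor_false]
      by_cases hu : u' = lo q
      · subst hu; simp
      · rw [decide_eq_false (fun h' => hu h'.symm)]
        simp only [Bool.false_eq_true, if_false]
        rw [if_neg]; rintro (⟨-, h2⟩ | ⟨h1, -⟩)
        · exact hu ((Fin.natAdd_inj 1).mp h2)
        · exact hzn _ h1
    · have ho' : o' = 0 := Fin.eq_zero o'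
      subst ho'
      simp only [e0z, e0n, etn', Bool.true_and, Bool.false_and, Bool.false_xor]
      by_cases hs : s' = lo q
      · subst hs; simp
      · rw [decide_eq_false (fun h' => hs h'.symm)]
        simp only [Bool.false_eq_true, if_false]
        rw [if_neg]; rintro (⟨h1, -⟩ | ⟨h1, -⟩)
        · exact hzn _ h1.symm
        · exact hs ((Fin.natAdd_inj 1).mp h1)
    · simp only [e0n, Bool.false_and, Bool.xor_false, Bool.false_eq_true, if_false]
      rw [if_neg]; rintro (⟨h1, -⟩ | ⟨-, h2⟩)
      · exact hzn _ h1.symm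
      · exact hzn _ h2.symm

end Summit.QuantumAdvantage.QuantumAdvantage.Theorems.CubicForrelation.NearExactIsExact
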